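import Literature.AlgebraicGeometry.HodgeTheory.HomComplex
import Literature.AlgebraicGeometry.Modules.SheafHomPushforwardLeft
import Literature.AlgebraicGeometry.Modules.PushforwardIsoAdjunction
import Literature.Algebra.Homology.TotalComplexMapFunctor
import HarnessLib

/-!
# The internal Hom complex along an isomorphism of schemes: `ε_* 𝓗om•(E•, L•) ≅ 𝓗om•(ε_* E•, ε_* L•)`

Layer `Literature/AlgebraicGeometry/HodgeTheory`; sequel to `HomComplex.lean` (the internal Hom complex
`homComplex X E L = 𝓗om•(E•, L•)`, total complex of the bicomplex `(q, i) ↦ 𝓗om(E^{-i}, L^q)`). For an isomorphism of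
schemes `ε : Y₀ ≅ Y₁` (so that `ε_*` is an equivalence of module categories, `Modules/PushforwardIsoAdjunction`):

* `homBicomplexPushforwardIso ε E L` — the Hom BICOMPLEX along `ε_*`: `ε_*••(𝓗om(E^{-i}, L^q))_{q,i} ≅ (𝓗om((ε_*E)^{-i}, (ε_*L)^q))_{q,i}`,
  componentwise the module-level `sheafHomPushforwardIso` (`Modules/SheafHomPushforward`), compatible with the horizontal
  differential by its naturality in the second variable (`PushforwardIsoUnit.pushforward_map_sheafHomMap_comp_comparison`) and with
  the vertical (signed, dual) differential by its naturality in the first variable (`SheafHomPushforwardLeft`);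
* **`homComplexPushforwardIso ε E L : ε_*• 𝓗om•(E•, L•) ≅ 𝓗om•(ε_*• E•, ε_*• L•)`** — the total complex commutes with the
  coproduct-preserving functor `ε_*` (`Literature.Algebra.Homology.mapTotalIso`) followed by `total.mapIso` of the bicomplex iso.

This is piece (N1) (object part) of the cell `pub-hodge-ring2`'s banked support target `HomComplex.IsISemiregularC.of_schemeIso`
(naturality of the venture HSemireg's `σ_q` under an isomorphism of the base). NOT here: naturality of `homComplexPushforwardIso` in
`L•` as a `NatIso` of the functors `𝓗om•(E•, –) ⋙ ε_*•` and `ε_*• ⋙ 𝓗om•(ε_*E•, –)` with its `CommShift` structure (piece (N1),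
functor part), the unit and the supertrace along `ε_*` ((N2), (N5)).

References: The Stacks project, *More on Algebra*, Section «Hom complexes» [StacksProject]; R. Hartshorne, *Algebraic Geometry*
(1977), II §5 pp. 109–110 [Hartshorne1977]; C. A. Weibel (1994), §1.2, 2.7.4–2.7.5 [Weibel1994]. Bookkeeping along an isomorphism (reading).
-/

noncomputable section

-- `TopCat.Presheaf`/`Scheme.Modules`/`GradedObject` are not reducible.
set_option backward.isDefEq.respectTransparency false

open CategoryTheory CategoryTheory.Category CategoryTheory.Limits AlgebraicGeometry Opposite
open AlgebraicGeometry.Scheme.Modules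

universe u

namespace Literature.AlgebraicGeometry.HodgeTheory

open Literature.AlgebraicGeometry.Modules Literature.Algebra.Homology

variable {Y₀ Y₁ : Scheme.{u}} (ε : Y₀ ≅ Y₁) (E L : CochainComplex Y₀.Modules ℤ)

/-- The Hom bicomplex `(q, i) ↦ 𝓗om(E^{-i}, L^q)` of `HomComplex.lean` (whose total complex is `homComplex X E L`), named.
[cite: StacksProject, More on Algebra, Section «Hom complexes»] -/
abbrev homBicomplex (X : Scheme.{u}) (E L : CochainComplex X.Modules ℤ) :
    HomologicalComplex₂ X.Modules (ComplexShape.up ℤ) (ComplexShape.up ℤ) :=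
  (((sheafHomBifunctor X).flip.mapBifunctorHomologicalComplex (ComplexShape.up ℤ) (ComplexShape.up ℤ)).obj L).obj
    (dualComplex X E)

/-- `homComplex X E L` is the total complex of `homBicomplex X E L` (definitionally).
[cite: StacksProject, More on Algebra, Section «Hom complexes»] -/
theorem homComplex_eq_total (X : Scheme.{u}) (E L : CochainComplex X.Modules ℤ) :
    homComplex X E L = (homBicomplex X E L).total (ComplexShape.up ℤ) := rfl

/-- **The Hom bicomplex along `ε_*`**: `ε_*(𝓗om(E^{-i}, L^q)) ≅ 𝓗om((ε_*E)^{-i}, (ε_*L)^q)` componentwise (`sheafHomPushforwardIso`),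
as an isomorphism of bicomplexes `ε_*••(homBicomplex Y₀ E L) ≅ homBicomplex Y₁ (ε_*E) (ε_*L)` — horizontal differentials by
naturality in the second variable, vertical (signed dual) differentials by naturality in the first variable.
[cite: Hartshorne1977, II §5 pp. 109–110 (the sheaf Hom and direct images f_*; reading: bookkeeping along an isomorphism of schemes)] -/
def homBicomplexPushforwardIso :
    mapBicomplex (pushforward ε.hom) (homBicomplex Y₀ E L) ≅
      homBicomplex Y₁ (((pushforward ε.hom).mapHomologicalComplex (ComplexShape.up ℤ)).obj E)
        (((pushforward ε.hom).mapHomologicalComplex (ComplexShape.up ℤ)).obj L) :=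
  HomologicalComplex.Hom.isoOfComponents
    (fun q => HomologicalComplex.Hom.isoOfComponents (fun i => sheafHomPushforwardIso ε (E.X (-i)) (L.X q))
      (fun i i' _ => by
        change sheafHomPushforwardComparison ε.hom (E.X (-i)) (L.X q) ≫
            sheafHomMapLeft (((i').negOnePow : ℤˣ) • (pushforward ε.hom).map (E.d (-i') (-i)))
              ((pushforward ε.hom).obj (L.X q)) =
          (pushforward ε.hom).map (sheafHomMapLeft (((i').negOnePow : ℤˣ) • E.d (-i') (-i)) (L.X q)) ≫
            sheafHomPushforwardComparison ε.hom (E.X (-i')) (L.X q)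
        rw [sheafHomMapLeft_units_smul, sheafHomMapLeft_units_smul, Units.smul_def, Units.smul_def, Functor.map_zsmul,
          Preadditive.comp_zsmul, Preadditive.zsmul_comp, pushforward_map_sheafHomMapLeft_comp_comparison]))
    (fun q q' _ => by
      refine HomologicalComplex.hom_ext _ _ fun i => ?_
      change sheafHomPushforwardComparison ε.hom (E.X (-i)) (L.X q) ≫
          sheafHomMap ((pushforward ε.hom).obj (E.X (-i))) ((pushforward ε.hom).map (L.d q q')) =
        (pushforward ε.hom).map (sheafHomMap (E.X (-i)) (L.d q q')) ≫ sheafHomPushforwardComparison ε.hom (E.X (-i)) (L.X q')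
      exact (pushforward_map_sheafHomMap_comp_comparison ε.hom (E.X (-i)) (L.d q q')).symm)

/-- Components of the bicomplex iso. [cite: Hartshorne1977, II §5 pp. 109–110 (the sheaf Hom and direct images f_*; reading: bookkeeping along an isomorphism of schemes)] -/
theorem homBicomplexPushforwardIso_hom_f_f (q i : ℤ) :
    ((homBicomplexPushforwardIso ε E L).hom.f q).f i = (sheafHomPushforwardIso ε (E.X (-i)) (L.X q)).hom := rfl

/-- **The internal Hom complex along an isomorphism of schemes**: `ε_*• 𝓗om•(E•, L•) ≅ 𝓗om•(ε_*• E•, ε_*• L•)` — `ε_*` (an equivalence)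
preserves the coproducts of the total complex (`mapTotalIso`), and the Hom bicomplexes correspond (`homBicomplexPushforwardIso`).
[cite: StacksProject, More on Algebra, Section «Hom complexes»] [cite: Weibel1994, §1.2, 1.2.6 and 2.7.4–2.7.5] -/
def homComplexPushforwardIso :
    ((pushforward ε.hom).mapHomologicalComplex (ComplexShape.up ℤ)).obj (homComplex Y₀ E L) ≅
      homComplex Y₁ (((pushforward ε.hom).mapHomologicalComplex (ComplexShape.up ℤ)).obj E)
        (((pushforward ε.hom).mapHomologicalComplex (ComplexShape.up ℤ)).obj L) :=
  (mapTotalIso (pushforward ε.hom) (homBicomplex Y₀ E L) (ComplexShape.up ℤ)).symm ≪≫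
    HomologicalComplex₂.total.mapIso (homBicomplexPushforwardIso ε E L) (ComplexShape.up ℤ)

/-- **On summands**: `ε_*(ι_{q,i}) ≫ (homComplexPushforwardIso).hom_n = (ε_* 𝓗om(E^{-i}, L^q) ≅ 𝓗om(ε_*E^{-i}, ε_*L^q)).hom ≫ ι'_{q,i}` —
the iso is the module-level `sheafHomPushforwardIso` summand by summand.
[cite: StacksProject, More on Algebra, Section «Hom complexes»] -/
theorem map_ι_comp_homComplexPushforwardIso_hom_f (q i n : ℤ) (h : q + i = n) :
    (pushforward ε.hom).map (HomComplex.ι Y₀ E L q i n h) ≫ (homComplexPushforwardIso ε E L).hom.f n =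
      (sheafHomPushforwardIso ε (E.X (-i)) (L.X q)).hom ≫
        HomComplex.ι Y₁ (((pushforward ε.hom).mapHomologicalComplex (ComplexShape.up ℤ)).obj E)
          (((pushforward ε.hom).mapHomologicalComplex (ComplexShape.up ℤ)).obj L) q i n h := by
  rw [homComplexPushforwardIso, Iso.trans_hom, HomologicalComplex.comp_f, Iso.symm_hom,
    HomologicalComplex₂.total.mapIso_hom]
  have hι : (pushforward ε.hom).map (HomComplex.ι Y₀ E L q i n h) ≫
      (mapTotalIso (pushforward ε.hom) (homBicomplex Y₀ E L) (ComplexShape.up ℤ)).inv.f n =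
      (mapBicomplex (pushforward ε.hom) (homBicomplex Y₀ E L)).ιTotal (ComplexShape.up ℤ) q i n h := by
    rw [← ιTotal_mapTotalIso_hom (pushforward ε.hom) (homBicomplex Y₀ E L) (ComplexShape.up ℤ) q i n h, Category.assoc,
      ← HomologicalComplex.comp_f, Iso.hom_inv_id, HomologicalComplex.id_f, Category.comp_id]
  rw [← Category.assoc, hι, HomologicalComplex₂.ιTotal_map, homBicomplexPushforwardIso_hom_f_f]

end Literature.AlgebraicGeometry.HodgeTheory

end
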